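import Literature.MathematicalPhysics.QuantumLattice.HubbardTorusBlochCurrentBound
import Literature.MathematicalPhysics.QuantumLattice.MagneticHubbardTorusGauge
import Literature.MathematicalPhysics.QuantumLattice.MagneticHubbardTorusTrivialField
import Summits.HubbardSuperconductivity.HubbardSuperconductivity.Theorems.BalabanIRBirEveryGroundStateSchur

/-!
# Route `KacWindowPenalty` — crux `WindowGap` (stmt-HubbardSuperconductivity-1088):
# pricing a penalised sector energy with Lieb–Schultz–Mattis twists of a ground state

For the Hubbard torus `H = hubbardTorus 2 L 1 U` (`L ≥ 3`), ANY perturbation `A`, any real `λ` and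
any integer winding `j`, the penalised sector energy is priced by the twisted ground state
`G_j ψ`, `G_j = phaseGauge (twistGauge L (2πj))` the Lieb–Schultz–Mattis twist unitary (a
site-phase transformation, sector preserving):

  `minEnergyOn (H + λA) K − minEnergyOn H K ≤ 2(1 − cos(2πj/L))·K₁(ψ) + 2 sin(2πj/L)·J̃₁(ψ)
                                              + λ · Re ⟨G_j ψ, A (G_j ψ)⟩`

for every unit vector `ψ` of the joint sector `K = szSector N M` attaining `minEnergyOn H K`
(`twistPricing_minEnergyOn_add_smul_sub`); `K₁(ψ) = Σ_{x,σ} Re ⟨ψ, c†_{x+e₁,σ} c_{x,σ} ψ⟩` is half the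
`e₁`-kinetic weight and `J̃₁(ψ)` the corresponding current sum, exactly as in the tree's Bloch bound
`bloch_intTwist_le`. Mechanism: `G_jᴴ (H + λA) G_j = H_{2πj} + λ G_jᴴ A G_j` with `H_{2πj}` the
uniformly twisted Peierls torus, gauge equivalent to `H` for integer flux quanta
(`magneticHubbardTorus_uniformTwistConfig_eq_conj_hubbardTorusFlux`, `hubbardTorusFlux_periodic`);
sector energies are invariant under site-phase conjugation (`minEnergyOn_szSector_phaseGauge_conj`);
the variational principle at `ψ` and the closed form of `Re ⟨ψ, H_{2πj} ψ⟩`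
(`re_star_dotProduct_magneticHubbardTorus_uniformTwistConfig_mulVec`) finish.

For the crux (`A = W_ε` the Kac-window pair penalty) this is the first step of the TWIST CEILING of
`Cruxes/WindowGap/NOTES.md` §3/§8: a twist of winding `j ≳ εL/2π` moves the pair condensate of `ψ`
out of the window `|q| ≤ ε` at kinetic cost `≈ (2πj/L)² K₁ ≈ ε² K₁`, so the window excess is bounded
by that cost plus `λ` times the window weight LEFT in the twisted state. Support for the crux
(`--supports stmt-HubbardSuperconductivity-1088`); no definitions, no named facts.
H. Watanabe, J. Stat. Phys. 177 (2019) 717, §2.2.1 (twist operator `U_m`, eqs. (13)–(16));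
E. Lieb, T. Schultz, D. Mattis, Ann. Phys. 16 (1961) 407; H. Tasaki (2020) §2.1.
-/

-- the mandated namespace `Summit.<Summit>.<Problem>.Theorems` repeats `HubbardSuperconductivity`
-- (single-problem summit, D-0017), which the `dupNamespace` linter flags on every declaration
set_option linter.dupNamespace false

noncomputable section

namespace Summit.HubbardSuperconductivity.HubbardSuperconductivity.Theorems

open Matrix Literature.MathematicalPhysics.QuantumLattice
  Literature.MathematicalPhysics.QuantumFieldTheory

variable {L : ℕ} [NeZero L]

/-- **Conjugating a perturbed Hubbard torus by an integer Lieb–Schultz–Mattis twist.** With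
`G_j = phaseGauge (twistGauge L (j·2π) ∘ toTorusSite)` and `L ≥ 3`:
`G_jᴴ (H + λA) G_j = H_{unif}(j·2π) + λ G_jᴴ A G_j`, where `H_{unif}(θ)` is the Peierls torus with
the uniform twist `e^{iθ/L}` on every `e₁`-bond — for `θ = 2πj` it is the site-phase conjugate of
`hubbardTorusFlux (2πj) = hubbardTorus` (integer flux quanta are invisible at the seam).
Watanabe (2019) §2.2.3. [folklore] -/
theorem phaseGauge_conj_hubbardTorus_add_smul (hL : 3 ≤ L) (U : ℝ)
    (A : Matrix (Finset (Orb (FermionTorus 2 L))) (Finset (Orb (FermionTorus 2 L))) ℂ)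
    (lam : ℝ) (j : ℤ) :
    (phaseGauge fun u : FermionTorus 2 L => twistGauge L (j * (2 * Real.pi)) u.toTorusSite)ᴴ *
        (hubbardTorus 2 L 1 U + (lam : ℂ) • A) *
        phaseGauge (fun u : FermionTorus 2 L => twistGauge L (j * (2 * Real.pi)) u.toTorusSite) =
      magneticHubbardTorus L (uniformTwistConfig L (j * (2 * Real.pi))) 1 U +
        (lam : ℂ) • ((phaseGauge fun u : FermionTorus 2 L =>
            twistGauge L (j * (2 * Real.pi)) u.toTorusSite)ᴴ * A *
          phaseGauge (fun u : FermionTorus 2 L => twistGauge L (j * (2 * Real.pi)) u.toTorusSite)) := by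
  rw [magneticHubbardTorus_uniformTwistConfig_eq_conj_hubbardTorusFlux hL U,
    (hubbardTorusFlux_periodic L U).int_mul_eq j, hubbardTorusFlux_zero, Matrix.mul_add,
    Matrix.add_mul, Matrix.mul_smul, Matrix.smul_mul]

/-- `Re ⟨ψ, (Gᴴ A G) ψ⟩ = Re ⟨G ψ, A (G ψ)⟩` for any matrices `G, A` (move `Gᴴ` across the
inner product). [folklore] -/
theorem re_star_dotProduct_conjTranspose_mul_mul_mulVec {n : Type*} [Fintype n]
    (G A : Matrix n n ℂ) (ψ : n → ℂ) :
    (star ψ ⬝ᵥ ((Gᴴ * A * G) *ᵥ ψ)).re = (star (G *ᵥ ψ) ⬝ᵥ (A *ᵥ (G *ᵥ ψ))).re := by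
  rw [← mulVec_mulVec, ← mulVec_mulVec, dotProduct_mulVec, vecMul_conjTranspose, star_star]

/-- **Twist pricing of a penalised sector energy** (`L ≥ 3`). For the Hubbard torus
`H = hubbardTorus 2 L 1 U`, any matrix `A`, any real `λ`, any winding `j : ℤ` and any unit vector
`ψ` of the joint sector `K = szSector N M` with `Re ⟨ψ, H ψ⟩ = minEnergyOn H K`:
`minEnergyOn (H + λA) K − minEnergyOn H K ≤ 2(1 − cos(2πj/L)) K₁(ψ) + 2 sin(2πj/L) J̃₁(ψ) +
λ Re ⟨G_j ψ, A (G_j ψ)⟩`, `G_j` the Lieb–Schultz–Mattis twist `phaseGauge (twistGauge L (2πj))`.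
Proof: `minEnergyOn (H + λA) K = minEnergyOn (G_jᴴ (H + λA) G_j) K`
(`minEnergyOn_szSector_phaseGauge_conj`) `≤ Re ⟨ψ, (H_{unif}(2πj) + λ G_jᴴ A G_j) ψ⟩`
(variational principle, `phaseGauge_conj_hubbardTorus_add_smul`), and
`Re ⟨ψ, H_{unif}(2πj) ψ⟩ = Re ⟨ψ, H ψ⟩ + 2(1 − cos(2πj/L)) K₁ + 2 sin(2πj/L) J̃₁`
(`re_star_dotProduct_magneticHubbardTorus_uniformTwistConfig_mulVec`).
Watanabe, J. Stat. Phys. 177 (2019) 717, §2.2.1 eqs. (13)–(16); Tasaki (2020) §2.1. [folklore] -/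
theorem twistPricing_minEnergyOn_add_smul_sub (hL : 3 ≤ L) (U : ℝ) (N : ℕ) (M : ℝ)
    (A : Matrix (Finset (Orb (FermionTorus 2 L))) (Finset (Orb (FermionTorus 2 L))) ℂ)
    (lam : ℝ) (j : ℤ) {ψ : Fock (Orb (FermionTorus 2 L))} (hψ : ψ ∈ szSector N M)
    (h1 : star ψ ⬝ᵥ ψ = 1)
    (hE : (star ψ ⬝ᵥ (hubbardTorus 2 L 1 U *ᵥ ψ)).re =
      (hubbardTorus 2 L 1 U).minEnergyOn (szSector N M)) :
    (hubbardTorus 2 L 1 U + (lam : ℂ) • A).minEnergyOn (szSector N M) -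
        (hubbardTorus 2 L 1 U).minEnergyOn (szSector N M) ≤
      2 * (1 - Real.cos (j * (2 * Real.pi) / L)) *
          (∑ x : Site 2 L, ∑ σ : Fin 2,
            (star ψ ⬝ᵥ ((creation (orb (FermionTorus.ofTorusSite (Site.shift x 0)) σ) *
              annihilation (orb (FermionTorus.ofTorusSite x) σ)) *ᵥ ψ)).re) +
        2 * Real.sin (j * (2 * Real.pi) / L) *
          (∑ x : Site 2 L, ∑ σ : Fin 2,
            (star ψ ⬝ᵥ ((creation (orb (FermionTorus.ofTorusSite (Site.shift x 0)) σ) *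
              annihilation (orb (FermionTorus.ofTorusSite x) σ)) *ᵥ ψ)).im) +
        lam * (star (phaseGauge (fun u : FermionTorus 2 L =>
              twistGauge L (j * (2 * Real.pi)) u.toTorusSite) *ᵥ ψ) ⬝ᵥ
            (A *ᵥ (phaseGauge (fun u : FermionTorus 2 L =>
              twistGauge L (j * (2 * Real.pi)) u.toTorusSite) *ᵥ ψ))).re := by
  set G : Matrix (Finset (Orb (FermionTorus 2 L))) (Finset (Orb (FermionTorus 2 L))) ℂ :=
    phaseGauge (fun u : FermionTorus 2 L => twistGauge L (j * (2 * Real.pi)) u.toTorusSite) with hG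
  -- unitary invariance of the penalised sector energy under the twist
  have hinv : (hubbardTorus 2 L 1 U + (lam : ℂ) • A).minEnergyOn (szSector N M) =
      (Gᴴ * (hubbardTorus 2 L 1 U + (lam : ℂ) • A) * G).minEnergyOn (szSector N M) :=
    (minEnergyOn_szSector_phaseGauge_conj _ _ N M).symm
  -- the variational principle at `ψ` for the conjugated operator
  have hvar := minEnergyOn_le_re_rayleigh (Gᴴ * (hubbardTorus 2 L 1 U + (lam : ℂ) • A) * G)
    (szSector N M) hψ h1
  rw [← hinv, hG, phaseGauge_conj_hubbardTorus_add_smul hL U A lam j, add_mulVec, dotProduct_add,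
    Complex.add_re, smul_mulVec, dotProduct_smul, smul_eq_mul, Complex.re_ofReal_mul,
    re_star_dotProduct_conjTranspose_mul_mul_mulVec,
    re_star_dotProduct_magneticHubbardTorus_uniformTwistConfig_mulVec,
    magneticHubbardTorus_one_eq_hubbardTorus hL, hE] at hvar
  linarith

end Summit.HubbardSuperconductivity.HubbardSuperconductivity.Theorems
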